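import Mathlib
import HarnessLib
import Literature.MathematicalPhysics.QuantumLattice.HubbardBandSectorCountingToolbox

/-!
# Route `KLProgramme` — support item `CountPairsOffset` (stmt-HubbardSuperconductivity-20036):
# the transversal grid count gated by an auxiliary Lipschitz quantity

One-dimensional counting tool for the Cooper range of the arbitrary-offset sector count (companion of
`KLProgrammeCountPairsOffsetNondeg.lean`): along a shift line `θ₃ = θ₂ + c` the transversality
`|d/dθ₂ h_P| ≥ h_min |c - π|` (`odd_transversal_offset`) holds only at points whose leg-2 partial `Γ` is small, so the grid
count must carry the gate `|Γ| ≤ Λ`; between two gated points within `Λ/M_Γ` of each other the gate stays `≤ 2Λ` by the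
Lipschitz bound, and the tree's chopping lemma `gridCard_le_chop` applies. Pattern of the tree's `pair_close_L3`/`gridCount_L3`
(ungated) and `gridCount_L5` (gated fold count). [folklore]-type elementary real analysis; references as in the companion file.
-/

noncomputable section

namespace Summit.HubbardSuperconductivity.HubbardSuperconductivity.Theorems.CountPairsOffset

set_option linter.dupNamespace false -- summit = problem name (single-conjunct summit), D-0017

open Real Set
open Literature.MathematicalPhysics.QuantumLattice Literature.MathematicalPhysics.QuantumLattice.BandSectorCounting

/-- (L3G) Gated transversality `|g| ≤ η₀ ∧ |Γ| ≤ 2Λ ⇒ |g'| ≥ λ`, with `|g'| ≤ M₁` and `Γ` `M_Γ`-Lipschitz: two points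
of `{|g| ≤ δ, |Γ| ≤ Λ}` (`δ ≤ η₀/2`) within `min (η₀/(2M₁)) (Λ/M_Γ)` of each other are within `2δ/λ`. -/
theorem pair_close_L3G {g g' Γ : ℝ → ℝ} (hg : ∀ z, HasDerivAt g (g' z) z) {M₁ MΓ lam η₀ Λ δ : ℝ}
    (hM : 0 < M₁) (hMΓ : 0 < MΓ) (hlam : 0 < lam) (hδη : δ ≤ η₀ / 2)
    (hbd : ∀ z, |g' z| ≤ M₁) (hΓ : ∀ z z', |Γ z - Γ z'| ≤ MΓ * |z - z'|)
    (htrans : ∀ z, |g z| ≤ η₀ → |Γ z| ≤ 2 * Λ → lam ≤ |g' z|)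
    {x y : ℝ} (hxy : x ≤ y) (hx : |g x| ≤ δ ∧ |Γ x| ≤ Λ) (hy : |g y| ≤ δ ∧ |Γ y| ≤ Λ)
    (hclose : y - x ≤ min (η₀ / (2 * M₁)) (Λ / MΓ)) : y - x ≤ 2 * δ / lam := by
  have hc1 : y - x ≤ η₀ / (2 * M₁) := hclose.trans (min_le_left _ _)
  have hc2 : y - x ≤ Λ / MΓ := hclose.trans (min_le_right _ _)
  have hder : ∀ z ∈ Icc x y, lam ≤ |g' z| := by
    intro z hz
    apply htrans
    · have e1 := abs_sub_le_of_abs_deriv_le hg (fun t _ => hbd t) hz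
      have e2 : M₁ * (z - x) ≤ η₀ / 2 := by
        calc M₁ * (z - x) ≤ M₁ * (η₀ / (2 * M₁)) := mul_le_mul_of_nonneg_left (by linarith [hz.2]) hM.le
          _ = η₀ / 2 := by field_simp
      have := abs_sub_abs_le_abs_sub (g z) (g x)
      linarith [hx.1]
    · have e1 := hΓ z x
      rw [abs_of_nonneg (by linarith [hz.1] : 0 ≤ z - x)] at e1
      have e2 : MΓ * (z - x) ≤ Λ := by
        calc MΓ * (z - x) ≤ MΓ * (Λ / MΓ) := mul_le_mul_of_nonneg_left (by linarith [hz.2]) hMΓ.le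
          _ = Λ := by field_simp
      have := abs_sub_abs_le_abs_sub (Γ z) (Γ x)
      linarith [hx.2]
  have h := mul_sub_le_abs_sub_of_le_abs_deriv hg hxy hlam hder
  have h2 : |g y - g x| ≤ 2 * δ := by
    calc |g y - g x| ≤ |g y| + |g x| := abs_sub _ _
      _ ≤ 2 * δ := by linarith [hx.1, hy.1]
  rw [le_div_iff₀ hlam]; nlinarith

/-- (L3G count) gated transversality: `#{i < N : |g(xᵢ)| ≤ δ, |Γ(xᵢ)| ≤ Λ} ≤ (Nw/ℓ + 1)·2(2δ/(λw) + 1)`,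
`ℓ = min (η₀/(2M₁)) (Λ/M_Γ)`. -/
theorem gridCount_L3G {g g' Γ : ℝ → ℝ} (hg : ∀ z, HasDerivAt g (g' z) z) {M₁ MΓ lam η₀ Λ δ : ℝ}
    (hM : 0 < M₁) (hMΓ : 0 < MΓ) (hlam : 0 < lam) (hη₀ : 0 < η₀) (hΛ : 0 < Λ) (hδ : 0 ≤ δ) (hδη : δ ≤ η₀ / 2)
    (hbd : ∀ z, |g' z| ≤ M₁) (hΓ : ∀ z z', |Γ z - Γ z'| ≤ MΓ * |z - z'|)
    (htrans : ∀ z, |g z| ≤ η₀ → |Γ z| ≤ 2 * Λ → lam ≤ |g' z|)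
    {x₀ w : ℝ} (hw : 0 < w) (N : ℕ) :
    ((((Finset.range N).filter fun i : ℕ => |g (x₀ + i * w)| ≤ δ ∧ |Γ (x₀ + i * w)| ≤ Λ).card : ℝ)) ≤
      (N * w / min (η₀ / (2 * M₁)) (Λ / MΓ) + 1) * (2 * ((2 * δ / lam) / w + 1)) := by
  classical
  refine gridCard_le_chop hw (lt_min (by positivity) (by positivity)) (by positivity)
    (fun x => |g x| ≤ δ ∧ |Γ x| ≤ Λ) (fun _ => True) fun i j hi hj hij hPi hPj _ hclose => ?_
  have hxy : x₀ + i * w ≤ x₀ + j * w := by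
    have : (i : ℝ) ≤ j := by exact_mod_cast hij
    nlinarith
  have := pair_close_L3G hg hM hMΓ hlam hδη hbd hΓ htrans hxy hPi hPj (by linarith)
  linarith

end Summit.HubbardSuperconductivity.HubbardSuperconductivity.Theorems.CountPairsOffset

end
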